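import Literature.MathematicalPhysics.QuantumFieldTheory.Balaban1983to89.B1Eq324BenfattoKernelSect5TupleClustersDecay
import HarnessLib

/-!
# `Balaban1983to89.B1Eq324BenfattoKernelSect5TupleClustersAnchored` — [BenfattoEtAl1978] Appendix D p. 166 / (5.11) p. 155: the Appendix D
# bound for tuple-class slots with the decay measured FROM THE ANCHOR TESSERA OF ONE SLOT'S OWN TUPLE, FOR A GENERAL SHIFTED GAUSSIAN KERNEL
# FIELD `𝒩(0,K)∘(u + ·)⁻¹` — `|𝓔^T_{μ_{K,u}}(Y₁,…,Y_k)| ≤ C·Σ_{T_{j₁}}|A^n_Δ|e^{−(ϰ/2)d(Δ)}e^{(δ/2)θ(Δ)}·Π_{j≠j₁} DM_j(Δ₀)` with the covariance decay,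
# the diagonal and the centre bound DISPLAYED AS ROWS — PROVED (row 5 of the cluster-side port map; the form the `Ψ₃` / (5.34) / `H^{(l)}`
# removals inside the free cumulants consume)

statement-level skeleton of published theorems with citation tags; proofs where landed; nothing here is a claim about the
Yang–Mills mass gap

WHY THIS MODULE (cell `pub-ymgap`, seat `dag-n08-b` gen 12 by the cluster lane's word; node N08 [Balaban1985UV3]; the [BenfattoEtAl1978] source
chain behind the (α)-row `h324c`; ROW 5 of `N08-PORT-MAP-CLUSTER-SIDE.md` §1).  `…B1Eq324BenfattoSect5TupleClustersAnchored` (seat n08-c) proves,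
for the CONDITIONED FREE FIELD `P̄(dz|z̄_Γ) = condField d α β Γ z̄`, Appendix D with every other slot's decay measured from the anchor `Δ₀` of the
small slot's own tuple — the supplier of the corrections removed INSIDE the free cumulants (`…Sect5FreePerturb.abs_cumulantOf_add_sub_le`, seat
n08-b, at `Γ = ∅`: `Ψ₃` ((5.24)), the (5.34) correction, `H^{(l)}` of (5.11)).  As for row 4, its proof reads the free field through exactly three
facts — the centre bound on the legs (a HYPOTHESIS already), the integrability of monomials, and the covariance decay F4
(`…AppendixDWick.abs_condCov_le_exp_l1`).  The class road (seats n08-b/n08-c/n08-d; `N08-BASICLEMMA-KERNEL-CENSUS.md`, the two PORT-MAP memos)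
needs the statement for the SHIFTED KERNEL FIELD `μ_{K,u} := (gaussianFieldOfKernel K).map (fun ζ y => u y + ζ y)` of a GENERIC
positive-semidefinite kernel `K` on `Q₀ = Site d` and a GENERIC centre `u`, with the facts as ROWS: R0 `hK : IsPosSemidefKernel K`, R1
`hdiag : ∀ y, K y y ≤ c₀` (integrability, row 2 `…KernelSect5PolyClusters.integrable_abs_monomial_pow_shift`), R2
`hdec : ∀ x y, |K x y| ≤ K₀·exp(−(δ₀·ℓ¹(x,y)))` read at any `0 ≤ δ ≤ δ₀` (the one decay row of rows 3/4), R3 `hu : |u| ≤ K₀` on the legs.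
This file is that edition: the SAME proofs with `abs_ursellOf_monomials_condField_le_exp ↦ …KernelSect5PolyClusters.abs_ursellOf_monomials_shift_le_exp`
(row 2, seat n08-c) and F4 replaced by R2; the slot geometry of `…Sect5TupleClusters` §1/§3 and `…TupleClustersDecay.exp_neg_max_le_prod_exp_neg_mean`
are measure-free and consumed BY NAME.  The currency is written as the literal term
`(gaussianFieldOfKernel K).map fun (ζ : Site d → ℝ) (y : Site d) => u y + ζ y` everywhere (memo §5.2), so that consumers close by `exact`;
§3 gives the faces for the CENTRED field `gaussianFieldOfKernel K` (`u = 0`: print's `𝓔̂^T_0`, the free side's `K_ref = K_Λ`).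

DICTIONARY.  As in `…KernelSect5TupleClustersDecay`; `DM_j(y)` = the mass of slot `j` weighted by `e^{−(δ/2k)·ℓ¹(y, Δ'₀)}`; the pair weight
`ρ(c₁, c)`; `C = 2^{kD}2^{2^{kD}}K₀^{kD}`.  The concrete module is the instance `K := condCov (freeCov d α β) Γ`, `u := condMean (freeCov d α β) Γ z̄`,
`δ₀ := log((2d+α²)/2d)`, `K₀ ≥ max(1, C₀₀)` (`…Sect5SlotMoments.condField_eq_map`, `rfl`; R2 from `abs_condCov_le_exp_l1`).

WHAT IS PROVED (theorems only; no definition, no named fact, no `sorry`; axioms standard).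
* §1 ★ `abs_ursellOf_poly_shift_le_anchored` — generic finite-index form under `μ_{K,u}` with a pair weight `ρ(c₁, c) ≥ 0`:
  `|𝓔^T_{μ_{K,u}}| ≤ C·Σ_{c₁}|a_{j₁c₁}|e^{(δ/2)θ_{c₁}}·Π_{j≠j₁}Σ_c|a_{jc}|e^{(δ/2)θ_c}e^{−(δ/(2k))ρ(c₁,c)}`.
* §2 ★★ **`abs_ursellOf_tupleSums_shift_le_anchored`** — tuple-class slots under `μ_{K,u}`, `ρ = ℓ¹` between anchors; ★
  `abs_ursellOf_tupleSums_shift_le_anchored_of_uniform` — with `DM_j(y) ≤ M_j` for all `y`: `|𝓔^T_{μ_{K,u}}(Y₁,…,Y_k)| ≤ C·𝓜̃_{j₁}·Π_{j≠j₁}M_j`.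
* §3 `abs_ursellOf_tupleSums_kernel_le_anchored`, `abs_ursellOf_tupleSums_kernel_le_anchored_of_uniform` — the same under the CENTRED
  `gaussianFieldOfKernel K` (row R3 discharged at `u = 0`; the face `…Sect5FreePerturb`'s kernel edition reads).

HONEST SCOPE / NOT HERE.  (i) The rows are DISPLAYED, not discharged (suppliers at the class's per-box instance: `…KernelOfPrecision` /
`…ClassAppendixC`, port map §2 — the instantiation row's business, with the comparison of the class's distance with `ℓ¹`); (ii) the one-point
lattice sums bounding `DM_j(y)` uniformly (`…RegionCount`, `…SlotMasses` — measure-free, reused AS IS), the application to `Ψ₃` / (5.34) / `H^{(l)}`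
and the error collection are the free side's / the assembly's; (iii) one self-located row of an UNCOMMISSIONED port (plan g81 (II), START-LIST v11
§n08; lane word n08-c g31 I.30870): nothing is chained to it here; no generalised Basic Lemma is stated; nothing of [Balaban1985UV3] (41)/(47)/(5)
is asserted; count-neutral for N08; nothing about d = 4, the continuum, OS axioms, a mass gap or the Clay problem.
-/

open Finset MeasureTheory
open scoped BigOperators NNReal

namespace Literature.MathematicalPhysics.QuantumFieldTheory.Balaban1983to89.B1Eq324BenfattoKernelSect5TupleClustersAnchored

open _root_.MeasureTheory _root_.ProbabilityTheory
open Literature.Probability.LatticeModels (ursellOf)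
open Literature.MathematicalPhysics.QuantumFieldTheory
open Literature.MathematicalPhysics.QuantumFieldTheory.Balaban1983to89.B1Eq324BenfattoLemma
open Literature.MathematicalPhysics.QuantumFieldTheory.Balaban1983to89.B1Eq324BenfattoConnLength (connLength_nonneg)
open Literature.MathematicalPhysics.QuantumFieldTheory.Balaban1983to89.B1Eq324BenfattoSect5Eq511 (term)
open Literature.MathematicalPhysics.QuantumFieldTheory.Balaban1983to89.B1Eq324BenfattoSect5PolyClusters
  (ursellOf_poly_eq_sum_colourings measurable_monomial)
open Literature.MathematicalPhysics.QuantumFieldTheory.Balaban1983to89.B1Eq324BenfattoKernelSect5PolyClusters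
  (abs_ursellOf_monomials_shift_le_exp integrable_abs_monomial_pow_shift)
open Literature.MathematicalPhysics.QuantumFieldTheory.Balaban1983to89.B1Eq324BenfattoSect5TupleClusters
  (tupleSum_eq_sum_option sum_abs_tcoef_mul_eq card_legs_le_of_mem site_of_mem_legs leg_mem_legs_of_mem l1_site_pseudo
   sum_sum_l1_legs_le appDConst_mono)
open Literature.MathematicalPhysics.QuantumFieldTheory.Balaban1983to89.B1Eq324BenfattoSect5TupleClustersDecay
  (exp_neg_max_le_prod_exp_neg_mean)

variable {d : ℕ} {K : B1Eq324BenfattoLemma.Site d → B1Eq324BenfattoLemma.Site d → ℝ}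
variable {s D : ℕ} {ϰ : ℝ} {a : Coef d} {Jr : Finset (B1Eq324BenfattoLemma.Site d)}
variable {σ : Type} [Fintype σ] [DecidableEq σ] [Nonempty σ]

/-- Shifting by the zero centre does nothing. [folklore] -/
private theorem map_add_zero_eq' (μ : Measure (B1Eq324BenfattoLemma.Site d → ℝ)) :
    (μ.map fun (ζ : B1Eq324BenfattoLemma.Site d → ℝ) (y : B1Eq324BenfattoLemma.Site d) => (0 : ℝ) + ζ y) = μ := by
  have h : (fun (ζ : B1Eq324BenfattoLemma.Site d → ℝ) (y : B1Eq324BenfattoLemma.Site d) => (0 : ℝ) + ζ y) = id := by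
    funext ζ y
    simp
  rw [h, Measure.map_id]

/-- One decay row read at a smaller rate: `|K x y| ≤ K₀e^{−δ₀ρ}` with `ρ ≥ 0`, `K₀ ≥ 0` and `δ ≤ δ₀` give `|K x y| ≤ K₀e^{−δρ}`. [folklore] -/
private theorem dec_of_le {K₀ δ₀ δ r t : ℝ} (hK₀ : 0 ≤ K₀) (hr : 0 ≤ r) (hδle : δ ≤ δ₀)
    (h : t ≤ K₀ * Real.exp (-(δ₀ * r))) : t ≤ K₀ * Real.exp (-(δ * r)) :=
  h.trans (mul_le_mul_of_nonneg_left (Real.exp_le_exp.2 (by nlinarith [mul_le_mul_of_nonneg_right hδle hr])) hK₀)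

omit [Nonempty σ] in
/-- The colouring sum conditioned on the colour of slot `j₁`: `Σ_{f : f j₁ = c₁} W₀(f j₁)·Π_{j≠j₁} W_j(f j₁, f j) = W₀(c₁)·Π_{j≠j₁}Σ_c W_j(c₁, c)`.
[folklore] -/
private theorem sum_filter_apply_eq_mul_prod {ι : Type*} [Fintype ι] [DecidableEq ι] (W₀ : ι → ℝ) (W : σ → ι → ι → ℝ)
    (j₁ : σ) (c₁ : ι) :
    ∑ f ∈ (Finset.univ : Finset (σ → ι)).filter (fun f => f j₁ = c₁), W₀ (f j₁) * ∏ j ∈ Finset.univ.erase j₁, W j (f j₁) (f j) =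
      W₀ c₁ * ∏ j ∈ Finset.univ.erase j₁, ∑ c, W j c₁ c := by
  classical
  set t : σ → Finset ι := Function.update (fun _ => (Finset.univ : Finset ι)) j₁ {c₁} with ht
  have hfilter : (Finset.univ : Finset (σ → ι)).filter (fun f => f j₁ = c₁) = Fintype.piFinset t := by
    ext f
    simp only [Finset.mem_filter, Finset.mem_univ, true_and, Fintype.mem_piFinset, ht]
    constructor
    · intro hf j
      by_cases hj : j = j₁
      · subst hj; rw [Function.update_self, Finset.mem_singleton]; exact hf
      · rw [Function.update_of_ne hj]; exact Finset.mem_univ _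
    · intro hf
      have := hf j₁
      rwa [Function.update_self, Finset.mem_singleton] at this
  set V : σ → ι → ℝ := Function.update (fun j c => W j c₁ c) j₁ (fun _ => W₀ c₁) with hV
  have hsummand : ∀ f ∈ Fintype.piFinset t, W₀ (f j₁) * ∏ j ∈ Finset.univ.erase j₁, W j (f j₁) (f j) = ∏ j, V j (f j) := by
    intro f hf
    have hf₁ : f j₁ = c₁ := by
      have := Fintype.mem_piFinset.1 hf j₁
      rwa [ht, Function.update_self, Finset.mem_singleton] at this
    rw [← Finset.mul_prod_erase Finset.univ (fun j => V j (f j)) (Finset.mem_univ j₁)]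
    congr 1
    · rw [hV, Function.update_self, hf₁]
    · refine Finset.prod_congr rfl fun j hj => ?_
      rw [hV, Function.update_of_ne (Finset.ne_of_mem_erase hj), hf₁]
  rw [hfilter, Finset.sum_congr rfl hsummand, ← Finset.prod_univ_sum t (fun j c => V j c),
    ← Finset.mul_prod_erase Finset.univ _ (Finset.mem_univ j₁)]
  congr 1
  · rw [ht, Function.update_self, Finset.sum_singleton, hV, Function.update_self]
  · refine Finset.prod_congr rfl fun j hj => ?_
    rw [ht, Function.update_of_ne (Finset.ne_of_mem_erase hj), hV, Function.update_of_ne (Finset.ne_of_mem_erase hj)]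

/-! ## §1  Appendix D with the decay measured from slot `j₁`'s own index, generic finite-index form under `μ_{K,u}` -/

/-- **APPENDIX D WITH THE DECAY MEASURED FROM SLOT `j₁`'S OWN INDEX, GENERIC FINITE-INDEX FORM, SHIFTED KERNEL FIELD**: slots
`Z_j = Σ_c a_{jc}·Π_{l∈J_c} z(x_{cl})` under `μ_{K,u} = 𝒩(0,K)∘(u + ·)⁻¹` (rows R0 `hK`, R1 `hdiag`, R2 `hdec : |K x y| ≤ K₀e^{−δ₀ℓ¹(x,y)}`,
R3 `|u| ≤ K₀` on the legs, `K₀ ≥ 1`; `≤ D` legs and intra-cluster `ℓ¹` sum `≤ θ_c` per index; rate `0 ≤ δ ≤ δ₀`), a PAIR weight `ρ(c₁, c) ≥ 0`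
such that every colouring with non-zero coefficients has, for every slot `j`, a leg of `f(j₁)` and a leg of `f(j)` at `ℓ¹` distance `≥ ρ(f(j₁), f(j))`:
`|𝓔^T_{μ_{K,u}}(Z₁,…,Z_k)| ≤ 2^{kD}2^{2^{kD}}K₀^{kD}·Σ_{c₁}|a_{j₁c₁}|e^{(δ/2)θ_{c₁}}·Π_{j≠j₁}Σ_c|a_{jc}|e^{(δ/2)θ_c}e^{−(δ/(2k))ρ(c₁,c)}` — the colouring sum
factorises conditionally on `f(j₁)`.  The concrete `…TupleClustersAnchored.abs_ursellOf_poly_condField_le_anchored` is the instance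
`K := condCov (freeCov d α β) Γ`, `u := condMean … z̄`, `δ₀ := log((2d+α²)/2d)`. [cite: BenfattoEtAl1978, Appendix D p.166 and (5.11) p.155] -/
theorem abs_ursellOf_poly_shift_le_anchored {ι : Type*} [Fintype ι] [Nonempty ι] {κ : Type}
    (hK : IsPosSemidefKernel K) (u : B1Eq324BenfattoLemma.Site d → ℝ) {c₀ : ℝ≥0} (hdiag : ∀ y, K y y ≤ c₀)
    (ac : σ → ι → ℝ) (Jm : ι → Finset κ) (xs : ι → κ → B1Eq324BenfattoLemma.Site d) {K₀ δ₀ : ℝ} (hK₀ : 1 ≤ K₀)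
    (hdec : ∀ x y : B1Eq324BenfattoLemma.Site d, |K x y| ≤ K₀ * Real.exp (-(δ₀ * ∑ jj, |((x jj : ℝ) - (y jj : ℝ))|)))
    (hu : ∀ c, ∀ l ∈ Jm c, |u (xs c l)| ≤ K₀)
    (hq : ∀ c, (Jm c).card ≤ D) (θ : ι → ℝ)
    (hθ : ∀ c, ∑ l ∈ Jm c, ∑ l' ∈ Jm c, ∑ jj, |((xs c l jj : ℝ) - (xs c l' jj : ℝ))| ≤ θ c)
    {δ : ℝ} (hδ : 0 ≤ δ) (hδle : δ ≤ δ₀)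
    (j₁ : σ) (ρ : ι → ι → ℝ) (hρ0 : ∀ c₁ c, 0 ≤ ρ c₁ c)
    (hsep : ∀ f : σ → ι, (∀ j, ac j (f j) ≠ 0) → ∀ j,
      ∃ l₁ ∈ Jm (f j₁), ∃ l₂ ∈ Jm (f j), ρ (f j₁) (f j) ≤ ∑ jj, |((xs (f j₁) l₁ jj : ℝ) - (xs (f j) l₂ jj : ℝ))|) :
    |ursellOf (fun P : Finset σ => ∫ z, ∏ j ∈ P, (∑ c, ac j c * ∏ l ∈ Jm c, z (xs c l))
        ∂((gaussianFieldOfKernel K).map fun (ζ : B1Eq324BenfattoLemma.Site d → ℝ) (y : B1Eq324BenfattoLemma.Site d) => u y + ζ y))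
        Finset.univ| ≤
      2 ^ (Fintype.card σ * D) * 2 ^ 2 ^ (Fintype.card σ * D) * K₀ ^ (Fintype.card σ * D) *
        ∑ c₁, |ac j₁ c₁| * Real.exp (δ / 2 * θ c₁) *
          ∏ j ∈ Finset.univ.erase j₁, ∑ c, |ac j c| * Real.exp (δ / 2 * θ c) *
            Real.exp (-(δ / (2 * Fintype.card σ) * ρ c₁ c)) := by
  classical
  haveI := isProbabilityMeasure_gaussianFieldOfKernel hK
  have hTm : Measurable (fun (ζ : B1Eq324BenfattoLemma.Site d → ℝ) (y : B1Eq324BenfattoLemma.Site d) => u y + ζ y) :=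
    measurable_pi_lambda _ fun y => measurable_const.add (measurable_pi_apply y)
  haveI : IsProbabilityMeasure ((gaussianFieldOfKernel K).map
      fun (ζ : B1Eq324BenfattoLemma.Site d → ℝ) (y : B1Eq324BenfattoLemma.Site d) => u y + ζ y) :=
    Measure.isProbabilityMeasure_map hTm.aemeasurable
  obtain ⟨h0, hsymm, htri, hnn⟩ := l1_site_pseudo (d := d)
  have hK₀0 : 0 ≤ K₀ := zero_le_one.trans hK₀
  have hCov : ∀ x y : B1Eq324BenfattoLemma.Site d, |K x y| ≤
      K₀ * Real.exp (-(δ * ∑ jj, |((x jj : ℝ) - (y jj : ℝ))|)) :=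
    fun x y => dec_of_le hK₀0 (hnn x y) hδle (hdec x y)
  have hm : ∀ (j : σ) (c : ι), AEStronglyMeasurable (fun z : B1Eq324BenfattoLemma.Site d → ℝ => ∏ l ∈ Jm c, z (xs c l))
      ((gaussianFieldOfKernel K).map
        fun (ζ : B1Eq324BenfattoLemma.Site d → ℝ) (y : B1Eq324BenfattoLemma.Site d) => u y + ζ y) :=
    fun j c => (measurable_monomial (Jm c) (xs c)).aestronglyMeasurable
  have hint : ∀ (j : σ) (c : ι) (q : ℕ), q ≤ Fintype.card σ →
      Integrable (fun z : B1Eq324BenfattoLemma.Site d → ℝ => |∏ l ∈ Jm c, z (xs c l)| ^ q)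
        ((gaussianFieldOfKernel K).map
          fun (ζ : B1Eq324BenfattoLemma.Site d → ℝ) (y : B1Eq324BenfattoLemma.Site d) => u y + ζ y) :=
    fun j c q _ => integrable_abs_monomial_pow_shift hK u hdiag (Jm c) (xs c) q
  rw [ursellOf_poly_eq_sum_colourings
    (μ := (gaussianFieldOfKernel K).map
      fun (ζ : B1Eq324BenfattoLemma.Site d → ℝ) (y : B1Eq324BenfattoLemma.Site d) => u y + ζ y) ac
    (fun (_ : σ) (c : ι) (z : B1Eq324BenfattoLemma.Site d → ℝ) => ∏ l ∈ Jm c, z (xs c l)) hm hint]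
  set C := (2 : ℝ) ^ (Fintype.card σ * D) * 2 ^ 2 ^ (Fintype.card σ * D) * K₀ ^ (Fintype.card σ * D) with hC
  have hC0 : 0 ≤ C := by positivity
  have hf : ∀ f : σ → ι,
      |(∏ j, ac j (f j)) * ursellOf (fun P : Finset σ => ∫ z, ∏ j ∈ P, ∏ l ∈ Jm (f j), z (xs (f j) l)
        ∂((gaussianFieldOfKernel K).map
          fun (ζ : B1Eq324BenfattoLemma.Site d → ℝ) (y : B1Eq324BenfattoLemma.Site d) => u y + ζ y)) Finset.univ| ≤
        C * ∏ j, (|ac j (f j)| * Real.exp (δ / 2 * θ (f j)) * Real.exp (-(δ / (2 * Fintype.card σ) * ρ (f j₁) (f j)))) := by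
    intro f
    by_cases hgood : ∀ j, ac j (f j) ≠ 0
    · -- the slot whose chosen index carries the largest weight
      obtain ⟨jm, -, hjm⟩ := Finset.exists_max_image (Finset.univ : Finset σ) (fun j => ρ (f j₁) (f j)) Finset.univ_nonempty
      obtain ⟨l₁, hl₁, l₂, hl₂, hρM⟩ := hsep f hgood jm
      have hAD := abs_ursellOf_monomials_shift_le_exp hK u (fun j => Jm (f j)) (fun j => xs (f j))
        (fun x y : B1Eq324BenfattoLemma.Site d => ∑ jj, |((x jj : ℝ) - (y jj : ℝ))|) h0 hsymm htri hnn hK₀ hδ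
        (fun j l hl => hu (f j) l hl) (fun j j' l _ l' _ => hCov (xs (f j) l) (xs (f j') l')) hl₁ hl₂
      have hN : ∑ j, (Jm (f j)).card ≤ Fintype.card σ * D := by
        calc ∑ j, (Jm (f j)).card ≤ ∑ _j : σ, D := Finset.sum_le_sum fun j _ => hq (f j)
          _ = Fintype.card σ * D := by rw [Finset.sum_const, smul_eq_mul, Finset.card_univ]
      have hI : ∑ j, ∑ l ∈ Jm (f j), ∑ l' ∈ Jm (f j), (∑ jj, |((xs (f j) l jj : ℝ) - (xs (f j) l' jj : ℝ))|) ≤ ∑ j, θ (f j) :=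
        Finset.sum_le_sum fun j _ => hθ (f j)
      have hmax := exp_neg_max_le_prod_exp_neg_mean (σ := σ) hδ (fun j => ρ (f j₁) (f j)) fun j => hjm j (Finset.mem_univ j)
      have hexp : Real.exp (-(δ / 2 * ((∑ jj, |((xs (f j₁) l₁ jj : ℝ) - (xs (f jm) l₂ jj : ℝ))|) -
          ∑ j, ∑ l ∈ Jm (f j), ∑ l' ∈ Jm (f j), ∑ jj, |((xs (f j) l jj : ℝ) - (xs (f j) l' jj : ℝ))|))) ≤
          (∏ j, Real.exp (-(δ / (2 * Fintype.card σ) * ρ (f j₁) (f j)))) * ∏ j, Real.exp (δ / 2 * θ (f j)) := by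
        refine le_trans ?_ (mul_le_mul_of_nonneg_right hmax (Finset.prod_nonneg fun j _ => (Real.exp_pos _).le))
        rw [← Real.exp_sum, ← Real.exp_add, Real.exp_le_exp, ← Finset.mul_sum]
        nlinarith
      rw [abs_mul, Finset.abs_prod]
      calc (∏ j, |ac j (f j)|) * |ursellOf (fun P : Finset σ => ∫ z, ∏ j ∈ P, ∏ l ∈ Jm (f j), z (xs (f j) l)
              ∂((gaussianFieldOfKernel K).map
                fun (ζ : B1Eq324BenfattoLemma.Site d → ℝ) (y : B1Eq324BenfattoLemma.Site d) => u y + ζ y)) Finset.univ|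
          ≤ (∏ j, |ac j (f j)|) * (C * ((∏ j, Real.exp (-(δ / (2 * Fintype.card σ) * ρ (f j₁) (f j)))) *
              ∏ j, Real.exp (δ / 2 * θ (f j)))) := by
            refine mul_le_mul_of_nonneg_left (hAD.trans ?_) (Finset.prod_nonneg fun j _ => abs_nonneg _)
            calc (2 : ℝ) ^ (∑ j, (Jm (f j)).card) * 2 ^ 2 ^ (∑ j, (Jm (f j)).card) * (K₀ ^ (∑ j, (Jm (f j)).card) *
                  Real.exp (-(δ / 2 * ((∑ jj, |((xs (f j₁) l₁ jj : ℝ) - (xs (f jm) l₂ jj : ℝ))|) -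
                    ∑ j, ∑ l ∈ Jm (f j), ∑ l' ∈ Jm (f j), ∑ jj, |((xs (f j) l jj : ℝ) - (xs (f j) l' jj : ℝ))|))))
                = (2 : ℝ) ^ (∑ j, (Jm (f j)).card) * 2 ^ 2 ^ (∑ j, (Jm (f j)).card) * K₀ ^ (∑ j, (Jm (f j)).card) *
                  Real.exp (-(δ / 2 * ((∑ jj, |((xs (f j₁) l₁ jj : ℝ) - (xs (f jm) l₂ jj : ℝ))|) -
                    ∑ j, ∑ l ∈ Jm (f j), ∑ l' ∈ Jm (f j), ∑ jj, |((xs (f j) l jj : ℝ) - (xs (f j) l' jj : ℝ))|))) := by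
                  ring
              _ ≤ C * ((∏ j, Real.exp (-(δ / (2 * Fintype.card σ) * ρ (f j₁) (f j)))) * ∏ j, Real.exp (δ / 2 * θ (f j))) :=
                  mul_le_mul (appDConst_mono hK₀ hN) hexp (Real.exp_pos _).le hC0
        _ = C * ∏ j, (|ac j (f j)| * Real.exp (δ / 2 * θ (f j)) * Real.exp (-(δ / (2 * Fintype.card σ) * ρ (f j₁) (f j)))) := by
            rw [Finset.prod_mul_distrib, Finset.prod_mul_distrib]; ring
    · obtain ⟨j, hj⟩ := not_forall.1 hgood
      have hj : ac j (f j) = 0 := not_ne_iff.1 hj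
      have hprod : ∏ j, ac j (f j) = 0 := Finset.prod_eq_zero (Finset.mem_univ j) hj
      have hprod' : ∏ j, (|ac j (f j)| * Real.exp (δ / 2 * θ (f j)) * Real.exp (-(δ / (2 * Fintype.card σ) * ρ (f j₁) (f j)))) = 0 :=
        Finset.prod_eq_zero (Finset.mem_univ j) (by rw [hj, abs_zero, zero_mul, zero_mul])
      rw [hprod, zero_mul, abs_zero, hprod', mul_zero]
  -- drop the weight of slot `j₁` itself and factorise the colouring sum conditionally on `f j₁`
  set W : σ → ι → ι → ℝ := fun j c₁ c =>
    |ac j c| * Real.exp (δ / 2 * θ c) * Real.exp (-(δ / (2 * Fintype.card σ) * ρ c₁ c)) with hW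
  set W₀ : ι → ℝ := fun c => |ac j₁ c| * Real.exp (δ / 2 * θ c) with hW₀
  have hf' : ∀ f : σ → ι,
      |(∏ j, ac j (f j)) * ursellOf (fun P : Finset σ => ∫ z, ∏ j ∈ P, ∏ l ∈ Jm (f j), z (xs (f j) l)
        ∂((gaussianFieldOfKernel K).map
          fun (ζ : B1Eq324BenfattoLemma.Site d → ℝ) (y : B1Eq324BenfattoLemma.Site d) => u y + ζ y)) Finset.univ| ≤
        C * (W₀ (f j₁) * ∏ j ∈ Finset.univ.erase j₁, W j (f j₁) (f j)) := by
    intro f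
    refine (hf f).trans (mul_le_mul_of_nonneg_left ?_ hC0)
    rw [← Finset.mul_prod_erase Finset.univ _ (Finset.mem_univ j₁)]
    refine mul_le_mul_of_nonneg_right ?_ (Finset.prod_nonneg fun j _ =>
      mul_nonneg (mul_nonneg (abs_nonneg _) (Real.exp_pos _).le) (Real.exp_pos _).le)
    have h1 : Real.exp (-(δ / (2 * Fintype.card σ) * ρ (f j₁) (f j₁))) ≤ 1 := by
      rw [Real.exp_le_one_iff, neg_nonpos]; exact mul_nonneg (by positivity) (hρ0 _ _)
    calc |ac j₁ (f j₁)| * Real.exp (δ / 2 * θ (f j₁)) * Real.exp (-(δ / (2 * Fintype.card σ) * ρ (f j₁) (f j₁)))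
        ≤ |ac j₁ (f j₁)| * Real.exp (δ / 2 * θ (f j₁)) * 1 :=
          mul_le_mul_of_nonneg_left h1 (mul_nonneg (abs_nonneg _) (Real.exp_pos _).le)
      _ = W₀ (f j₁) := mul_one _
  refine (Finset.abs_sum_le_sum_abs _ _).trans ((Finset.sum_le_sum fun f _ => hf' f).trans (le_of_eq ?_))
  rw [← Finset.mul_sum, ← Finset.sum_fiberwise (Finset.univ : Finset (σ → ι)) (fun f => f j₁)
    (fun f => W₀ (f j₁) * ∏ j ∈ Finset.univ.erase j₁, W j (f j₁) (f j))]
  congr 1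
  exact Finset.sum_congr rfl fun c₁ _ => sum_filter_apply_eq_mul_prod W₀ W j₁ c₁

/-! ## §2  Tuple-class slots under `μ_{K,u}` -/

/-- **APPENDIX D WITH THE DECAY MEASURED FROM THE ANCHOR OF SLOT `j₁`'S TUPLE, TUPLE-CLASS FORM, SHIFTED KERNEL FIELD**: slots
`Y_j = Σ_pΣ_{Δ∈T_j p}Σ_n A^n_Δ e^{−(ϰ/2)d(Δ)} Π z_{Δᵢ}^{nᵢ}` under `μ_{K,u}` (rows R0 `hK`, R1 `hdiag`, R2 `hdec`, R3 `|u| ≤ K₀` on the tuples' tesserae,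
`K₀ ≥ 1`, rate `0 ≤ δ ≤ δ₀`), for ANY slot `j₁` (no localisation hypothesis):
`|𝓔^T_{μ_{K,u}}(Y₁,…,Y_k)| ≤ 2^{kD}2^{2^{kD}}K₀^{kD}·Σ_{T_{j₁}}|A^n_Δ|e^{−(ϰ/2)d(Δ)}e^{(δ/2)D²(√d·d(Δ)+d)}·Π_{j≠j₁}Σ_{T_j}|A^{n'}_{Δ'}|e^{−(ϰ/2)d(Δ')}e^{(δ/2)D²(√d·d(Δ')+d)}e^{−(δ/(2k))ℓ¹(Δ₀,Δ'₀)}`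
(`Δ₀, Δ'₀` the anchor tesserae).  The concrete `…TupleClustersAnchored.abs_ursellOf_tupleSums_condField_le_anchored` is the instance
`K := condCov (freeCov d α β) Γ`, `u := condMean … z̄`. [cite: BenfattoEtAl1978, Appendix D p.166 and (5.11) p.155] -/
theorem abs_ursellOf_tupleSums_shift_le_anchored
    (hK : IsPosSemidefKernel K) (u : B1Eq324BenfattoLemma.Site d → ℝ) {c₀ : ℝ≥0} (hdiag : ∀ y, K y y ≤ c₀)
    (T : σ → (p : ℕ) → Finset (Fin p → Jr)) {K₀ δ₀ : ℝ} (hK₀ : 1 ≤ K₀)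
    (hdec : ∀ x y : B1Eq324BenfattoLemma.Site d, |K x y| ≤ K₀ * Real.exp (-(δ₀ * ∑ jj, |((x jj : ℝ) - (y jj : ℝ))|)))
    (hu : ∀ j, ∀ p ∈ Finset.Icc 1 s, ∀ Δ ∈ T j p, ∀ i, |u (Δ i : B1Eq324BenfattoLemma.Site d)| ≤ K₀)
    {δ : ℝ} (hδ : 0 ≤ δ) (hδle : δ ≤ δ₀) (j₁ : σ) :
    |ursellOf (fun P : Finset σ => ∫ z, ∏ j ∈ P,
        (∑ p ∈ Finset.Icc 1 s, ∑ Δ ∈ T j p, ∑ n ∈ admissible p D, term ϰ a z p Δ n)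
        ∂((gaussianFieldOfKernel K).map fun (ζ : B1Eq324BenfattoLemma.Site d → ℝ) (y : B1Eq324BenfattoLemma.Site d) => u y + ζ y))
        Finset.univ| ≤
      2 ^ (Fintype.card σ * D) * 2 ^ 2 ^ (Fintype.card σ * D) * K₀ ^ (Fintype.card σ * D) *
        ∑ p₁ ∈ Finset.Icc 1 s, ∑ Δ₁ ∈ T j₁ p₁, ∑ n₁ ∈ admissible p₁ D,
          |a p₁ (fun i => (Δ₁ i : B1Eq324BenfattoLemma.Site d)) n₁| *
            Real.exp (-(ϰ / 2) * connLength fun i => (Δ₁ i : B1Eq324BenfattoLemma.Site d)) *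
            Real.exp (δ / 2 * ((D : ℝ) ^ 2 * (Real.sqrt d * connLength (fun i => (Δ₁ i : B1Eq324BenfattoLemma.Site d)) + d))) *
          ∏ j ∈ Finset.univ.erase j₁, ∑ p ∈ Finset.Icc 1 s, ∑ Δ ∈ T j p, ∑ n ∈ admissible p D,
            |a p (fun i => (Δ i : B1Eq324BenfattoLemma.Site d)) n| *
              Real.exp (-(ϰ / 2) * connLength fun i => (Δ i : B1Eq324BenfattoLemma.Site d)) *
              (Real.exp (δ / 2 * ((D : ℝ) ^ 2 * (Real.sqrt d * connLength (fun i => (Δ i : B1Eq324BenfattoLemma.Site d)) + d))) *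
                Real.exp (-(δ / (2 * Fintype.card σ) * ∑ jj,
                  |(((if h : 0 < p₁ then (Δ₁ ⟨0, h⟩ : B1Eq324BenfattoLemma.Site d) else (0 : B1Eq324BenfattoLemma.Site d)) jj : ℝ) -
                    ((if h : 0 < p then (Δ ⟨0, h⟩ : B1Eq324BenfattoLemma.Site d) else (0 : B1Eq324BenfattoLemma.Site d)) jj : ℝ))|))) := by
  classical
  simp_rw [tupleSum_eq_sum_option T]
  obtain ⟨-, -, -, hnn⟩ := l1_site_pseudo (d := d)
  have hmem : ∀ c : ↥((Finset.Icc 1 s).sigma fun p =>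
      (Finset.univ.filter fun Δ : Fin p → Jr => ∃ j', Δ ∈ T j' p) ×ˢ admissible p D),
      c.1.1 ∈ Finset.Icc 1 s ∧ (∃ j', c.1.2.1 ∈ T j' c.1.1) ∧ c.1.2.2 ∈ admissible c.1.1 D := by
    intro c
    have h := Finset.mem_sigma.1 c.2
    have h2 := Finset.mem_product.1 h.2
    exact ⟨h.1, (Finset.mem_filter.1 h2.1).2, h2.2⟩
  have hpos : ∀ c : ↥((Finset.Icc 1 s).sigma fun p =>
      (Finset.univ.filter fun Δ : Fin p → Jr => ∃ j', Δ ∈ T j' p) ×ˢ admissible p D), 0 < c.1.1 :=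
    fun c => (Finset.mem_Icc.1 (hmem c).1).1
  -- anchor of an encoded index (`0` for the dummy index `none`)
  set anc : Option ↥((Finset.Icc 1 s).sigma fun p =>
      (Finset.univ.filter fun Δ : Fin p → Jr => ∃ j', Δ ∈ T j' p) ×ˢ admissible p D) → B1Eq324BenfattoLemma.Site d :=
    fun c => c.elim 0 fun c => (c.1.2.1 ⟨0, hpos c⟩ : B1Eq324BenfattoLemma.Site d) with hanc
  refine (abs_ursellOf_poly_shift_le_anchored (D := D) hK u hdiag _ _ _ hK₀ hdec ?_ ?_
    (fun c : Option ↥((Finset.Icc 1 s).sigma fun p =>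
        (Finset.univ.filter fun Δ : Fin p → Jr => ∃ j', Δ ∈ T j' p) ×ˢ admissible p D) => c.elim 0 fun c =>
      (D : ℝ) ^ 2 * (Real.sqrt d * connLength (fun i => (c.1.2.1 i : B1Eq324BenfattoLemma.Site d)) + d)) ?_ hδ hδle j₁
    (fun c₁ c => ∑ jj, |((anc c₁ jj : ℝ) - (anc c jj : ℝ))|) (fun c₁ c => hnn _ _) ?_).trans (le_of_eq ?_)
  · rintro (_ | c) l hl
    · simp only [Option.elim_none, Finset.notMem_empty] at hl
    · simp only [Option.elim_some] at hl ⊢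
      obtain ⟨i, hi⟩ := site_of_mem_legs (Jr := Jr) (Δ := c.1.2.1) hl
      obtain ⟨hp, ⟨j', hj'⟩, -⟩ := hmem c
      rw [hi]; exact hu j' _ hp _ hj' i
  · rintro (_ | c)
    · simp only [Option.elim_none, Finset.card_empty]; exact Nat.zero_le _
    · simp only [Option.elim_some]; exact card_legs_le_of_mem (hmem c).2.2
  · rintro (_ | c)
    · simp only [Option.elim_none, Finset.sum_empty]; exact le_rfl
    · simp only [Option.elim_some]
      exact sum_sum_l1_legs_le (D := D) c.1.2.1 (hmem c).2.2
  · intro f hf j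
    have hcls : ∀ j, ∃ c, f j = some c ∧ c.1.2.1 ∈ T j c.1.1 := by
      intro j
      have h := hf j
      rcases hfj : f j with _ | c
      · rw [hfj] at h; exact absurd rfl h
      · rw [hfj] at h
        simp only [Option.elim_some] at h
        by_cases hc : c.1.2.1 ∈ T j c.1.1
        · exact ⟨c, rfl, hc⟩
        · exact absurd (if_neg hc) h
    obtain ⟨c₁, hc₁, -⟩ := hcls j₁
    obtain ⟨c₂, hc₂, -⟩ := hcls j
    refine ⟨(((⟨0, hpos c₁⟩ : Fin c₁.1.1) : ℕ), 0), ?_, (((⟨0, hpos c₂⟩ : Fin c₂.1.1) : ℕ), 0), ?_, ?_⟩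
    · rw [hc₁]; exact leg_mem_legs_of_mem (hmem c₁).2.2 ⟨0, hpos c₁⟩
    · rw [hc₂]; exact leg_mem_legs_of_mem (hmem c₂).2.2 ⟨0, hpos c₂⟩
    · rw [hc₁, hc₂]
      simp only [hanc, Option.elim_some]
      rw [dif_pos (hpos c₁), dif_pos (hpos c₂)]
  · -- identify the two index sums with the displayed tuple sums
    congr 1
    rw [Fintype.sum_option]
    simp only [Option.elim_none, abs_zero, zero_mul, zero_add]
    have h₁ := sum_abs_tcoef_mul_eq (s := s) (D := D) (ϰ := ϰ) (a := a) T j₁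
      (fun c₁ => Real.exp (δ / 2 * ((D : ℝ) ^ 2 * (Real.sqrt d * connLength (fun i => (c₁.2.1 i : B1Eq324BenfattoLemma.Site d)) + d))) *
        ∏ j ∈ Finset.univ.erase j₁, ∑ p ∈ Finset.Icc 1 s, ∑ Δ ∈ T j p, ∑ n ∈ admissible p D,
            |a p (fun i => (Δ i : B1Eq324BenfattoLemma.Site d)) n| *
              Real.exp (-(ϰ / 2) * connLength fun i => (Δ i : B1Eq324BenfattoLemma.Site d)) *
              (Real.exp (δ / 2 * ((D : ℝ) ^ 2 * (Real.sqrt d * connLength (fun i => (Δ i : B1Eq324BenfattoLemma.Site d)) + d))) *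
                Real.exp (-(δ / (2 * Fintype.card σ) * ∑ jj,
                  |(((if h : 0 < c₁.1 then (c₁.2.1 ⟨0, h⟩ : B1Eq324BenfattoLemma.Site d)
                      else (0 : B1Eq324BenfattoLemma.Site d)) jj : ℝ) -
                    ((if h : 0 < p then (Δ ⟨0, h⟩ : B1Eq324BenfattoLemma.Site d)
                      else (0 : B1Eq324BenfattoLemma.Site d)) jj : ℝ))|))))
    refine Eq.trans (Finset.sum_congr rfl fun c₁ _ => ?_) (h₁.trans (Finset.sum_congr rfl fun p₁ _ =>
      Finset.sum_congr rfl fun Δ₁ _ => Finset.sum_congr rfl fun n₁ _ => by rw [← mul_assoc]))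
    simp only [Option.elim_some]
    rw [mul_assoc]
    congr 1
    congr 1
    refine Finset.prod_congr rfl fun j _ => ?_
    rw [Fintype.sum_option]
    simp only [Option.elim_none, abs_zero, zero_mul, zero_add]
    have h₂ := sum_abs_tcoef_mul_eq (s := s) (D := D) (ϰ := ϰ) (a := a) T j
      (fun c => Real.exp (δ / 2 * ((D : ℝ) ^ 2 * (Real.sqrt d * connLength (fun i => (c.2.1 i : B1Eq324BenfattoLemma.Site d)) + d))) *
        Real.exp (-(δ / (2 * Fintype.card σ) * ∑ jj,
          |(((if h : 0 < c₁.1.1 then (c₁.1.2.1 ⟨0, h⟩ : B1Eq324BenfattoLemma.Site d)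
              else (0 : B1Eq324BenfattoLemma.Site d)) jj : ℝ) -
            ((if h : 0 < c.1 then (c.2.1 ⟨0, h⟩ : B1Eq324BenfattoLemma.Site d)
              else (0 : B1Eq324BenfattoLemma.Site d)) jj : ℝ))|)))
    refine Eq.trans (Finset.sum_congr rfl fun c _ => ?_) h₂
    simp only [hanc, Option.elim_some]
    rw [dif_pos (hpos c₁), dif_pos (hpos c), mul_assoc]

/-- **THE UNIFORM FORM, SHIFTED KERNEL FIELD**: if every other slot's anchor-weighted mass is bounded uniformly in the anchor, `DM_j(y) ≤ M_j` for all `y`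
(`…RegionCount.decayWeighted_classSum_le_card_mul` at `R_A = {y}`), then
`|𝓔^T_{μ_{K,u}}(Y₁,…,Y_k)| ≤ 2^{kD}2^{2^{kD}}K₀^{kD}·𝓜̃_{j₁}·Π_{j≠j₁}M_j`, `𝓜̃_{j₁} = Σ_{T_{j₁}}|A^n_Δ|e^{−(ϰ/2)d(Δ)}e^{(δ/2)D²(√d·d(Δ)+d)}` — the mass of
the SMALL slot times `O(A)^{k−1}`.  The concrete `…TupleClustersAnchored.abs_ursellOf_tupleSums_condField_le_anchored_of_uniform` is the instance
`K := condCov (freeCov d α β) Γ`, `u := condMean … z̄`. [cite: BenfattoEtAl1978, Appendix D p.166 and (5.11) p.155] -/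
theorem abs_ursellOf_tupleSums_shift_le_anchored_of_uniform
    (hK : IsPosSemidefKernel K) (u : B1Eq324BenfattoLemma.Site d → ℝ) {c₀ : ℝ≥0} (hdiag : ∀ y, K y y ≤ c₀)
    (T : σ → (p : ℕ) → Finset (Fin p → Jr)) {K₀ δ₀ : ℝ} (hK₀ : 1 ≤ K₀)
    (hdec : ∀ x y : B1Eq324BenfattoLemma.Site d, |K x y| ≤ K₀ * Real.exp (-(δ₀ * ∑ jj, |((x jj : ℝ) - (y jj : ℝ))|)))
    (hu : ∀ j, ∀ p ∈ Finset.Icc 1 s, ∀ Δ ∈ T j p, ∀ i, |u (Δ i : B1Eq324BenfattoLemma.Site d)| ≤ K₀)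
    {δ : ℝ} (hδ : 0 ≤ δ) (hδle : δ ≤ δ₀) (j₁ : σ) (M : σ → ℝ)
    (hM : ∀ j, j ≠ j₁ → ∀ y : B1Eq324BenfattoLemma.Site d,
      ∑ p ∈ Finset.Icc 1 s, ∑ Δ ∈ T j p, ∑ n ∈ admissible p D,
        |a p (fun i => (Δ i : B1Eq324BenfattoLemma.Site d)) n| *
          Real.exp (-(ϰ / 2) * connLength fun i => (Δ i : B1Eq324BenfattoLemma.Site d)) *
          (Real.exp (δ / 2 * ((D : ℝ) ^ 2 * (Real.sqrt d * connLength (fun i => (Δ i : B1Eq324BenfattoLemma.Site d)) + d))) *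
            Real.exp (-(δ / (2 * Fintype.card σ) * ∑ jj, |((y jj : ℝ) -
              ((if h : 0 < p then (Δ ⟨0, h⟩ : B1Eq324BenfattoLemma.Site d) else (0 : B1Eq324BenfattoLemma.Site d)) jj : ℝ))|))) ≤ M j) :
    |ursellOf (fun P : Finset σ => ∫ z, ∏ j ∈ P,
        (∑ p ∈ Finset.Icc 1 s, ∑ Δ ∈ T j p, ∑ n ∈ admissible p D, term ϰ a z p Δ n)
        ∂((gaussianFieldOfKernel K).map fun (ζ : B1Eq324BenfattoLemma.Site d → ℝ) (y : B1Eq324BenfattoLemma.Site d) => u y + ζ y))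
        Finset.univ| ≤
      2 ^ (Fintype.card σ * D) * 2 ^ 2 ^ (Fintype.card σ * D) * K₀ ^ (Fintype.card σ * D) *
        (∑ p₁ ∈ Finset.Icc 1 s, ∑ Δ₁ ∈ T j₁ p₁, ∑ n₁ ∈ admissible p₁ D,
          |a p₁ (fun i => (Δ₁ i : B1Eq324BenfattoLemma.Site d)) n₁| *
            Real.exp (-(ϰ / 2) * connLength fun i => (Δ₁ i : B1Eq324BenfattoLemma.Site d)) *
            Real.exp (δ / 2 * ((D : ℝ) ^ 2 * (Real.sqrt d * connLength (fun i => (Δ₁ i : B1Eq324BenfattoLemma.Site d)) + d)))) *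
        ∏ j ∈ Finset.univ.erase j₁, M j := by
  refine (abs_ursellOf_tupleSums_shift_le_anchored (D := D) (ϰ := ϰ) (a := a) hK u hdiag T hK₀ hdec hu hδ hδle j₁).trans ?_
  rw [mul_assoc _ (∑ p₁ ∈ Finset.Icc 1 s, _) (∏ j ∈ Finset.univ.erase j₁, M j), Finset.sum_mul]
  refine mul_le_mul_of_nonneg_left ?_ (by positivity)
  simp_rw [Finset.sum_mul]
  refine Finset.sum_le_sum fun p₁ hp₁ => Finset.sum_le_sum fun Δ₁ _ => Finset.sum_le_sum fun n₁ _ => ?_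
  refine mul_le_mul_of_nonneg_left (Finset.prod_le_prod (fun j _ => Finset.sum_nonneg fun p _ => Finset.sum_nonneg fun Δ _ =>
    Finset.sum_nonneg fun n _ => mul_nonneg (mul_nonneg (abs_nonneg _) (Real.exp_pos _).le)
      (mul_nonneg (Real.exp_pos _).le (Real.exp_pos _).le)) fun j hj => ?_)
    (mul_nonneg (mul_nonneg (abs_nonneg _) (Real.exp_pos _).le) (Real.exp_pos _).le)
  exact hM j (Finset.ne_of_mem_erase hj) _

/-! ## §3  The centred faces `u = 0`: print's `𝓔̂^T_0` / the class road's `K_ref = K_Λ` -/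

/-- **TUPLE-CLASS FORM, CENTRED KERNEL FIELD `𝒩(0,K)`**: the instance `u = 0` of `abs_ursellOf_tupleSums_shift_le_anchored` (row R3 discharged),
stated for `gaussianFieldOfKernel K` itself. [cite: BenfattoEtAl1978, Appendix D p.166 and (5.11) p.155] -/
theorem abs_ursellOf_tupleSums_kernel_le_anchored
    (hK : IsPosSemidefKernel K) {c₀ : ℝ≥0} (hdiag : ∀ y, K y y ≤ c₀)
    (T : σ → (p : ℕ) → Finset (Fin p → Jr)) {K₀ δ₀ : ℝ} (hK₀ : 1 ≤ K₀)
    (hdec : ∀ x y : B1Eq324BenfattoLemma.Site d, |K x y| ≤ K₀ * Real.exp (-(δ₀ * ∑ jj, |((x jj : ℝ) - (y jj : ℝ))|)))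
    {δ : ℝ} (hδ : 0 ≤ δ) (hδle : δ ≤ δ₀) (j₁ : σ) :
    |ursellOf (fun P : Finset σ => ∫ z, ∏ j ∈ P,
        (∑ p ∈ Finset.Icc 1 s, ∑ Δ ∈ T j p, ∑ n ∈ admissible p D, term ϰ a z p Δ n) ∂(gaussianFieldOfKernel K))
        Finset.univ| ≤
      2 ^ (Fintype.card σ * D) * 2 ^ 2 ^ (Fintype.card σ * D) * K₀ ^ (Fintype.card σ * D) *
        ∑ p₁ ∈ Finset.Icc 1 s, ∑ Δ₁ ∈ T j₁ p₁, ∑ n₁ ∈ admissible p₁ D,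
          |a p₁ (fun i => (Δ₁ i : B1Eq324BenfattoLemma.Site d)) n₁| *
            Real.exp (-(ϰ / 2) * connLength fun i => (Δ₁ i : B1Eq324BenfattoLemma.Site d)) *
            Real.exp (δ / 2 * ((D : ℝ) ^ 2 * (Real.sqrt d * connLength (fun i => (Δ₁ i : B1Eq324BenfattoLemma.Site d)) + d))) *
          ∏ j ∈ Finset.univ.erase j₁, ∑ p ∈ Finset.Icc 1 s, ∑ Δ ∈ T j p, ∑ n ∈ admissible p D,
            |a p (fun i => (Δ i : B1Eq324BenfattoLemma.Site d)) n| *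
              Real.exp (-(ϰ / 2) * connLength fun i => (Δ i : B1Eq324BenfattoLemma.Site d)) *
              (Real.exp (δ / 2 * ((D : ℝ) ^ 2 * (Real.sqrt d * connLength (fun i => (Δ i : B1Eq324BenfattoLemma.Site d)) + d))) *
                Real.exp (-(δ / (2 * Fintype.card σ) * ∑ jj,
                  |(((if h : 0 < p₁ then (Δ₁ ⟨0, h⟩ : B1Eq324BenfattoLemma.Site d) else (0 : B1Eq324BenfattoLemma.Site d)) jj : ℝ) -
                    ((if h : 0 < p then (Δ ⟨0, h⟩ : B1Eq324BenfattoLemma.Site d) else (0 : B1Eq324BenfattoLemma.Site d)) jj : ℝ))|))) := by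
  have h := abs_ursellOf_tupleSums_shift_le_anchored (s := s) (D := D) (ϰ := ϰ) (a := a) hK (fun _ => (0 : ℝ)) hdiag T hK₀ hdec
    (fun j p _ Δ _ i => by rw [abs_zero]; exact zero_le_one.trans hK₀) hδ hδle j₁
  rwa [map_add_zero_eq'] at h

/-- **THE UNIFORM FORM, CENTRED KERNEL FIELD `𝒩(0,K)`**: the instance `u = 0` of `abs_ursellOf_tupleSums_shift_le_anchored_of_uniform` — the face
the kernel edition of `…Sect5FreePerturb.abs_cumulantOf_add_sub_le` reads (concrete: `P̂₀ = condField d α β ∅ 0`).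
[cite: BenfattoEtAl1978, Appendix D p.166 and (5.11) p.155] -/
theorem abs_ursellOf_tupleSums_kernel_le_anchored_of_uniform
    (hK : IsPosSemidefKernel K) {c₀ : ℝ≥0} (hdiag : ∀ y, K y y ≤ c₀)
    (T : σ → (p : ℕ) → Finset (Fin p → Jr)) {K₀ δ₀ : ℝ} (hK₀ : 1 ≤ K₀)
    (hdec : ∀ x y : B1Eq324BenfattoLemma.Site d, |K x y| ≤ K₀ * Real.exp (-(δ₀ * ∑ jj, |((x jj : ℝ) - (y jj : ℝ))|)))
    {δ : ℝ} (hδ : 0 ≤ δ) (hδle : δ ≤ δ₀) (j₁ : σ) (M : σ → ℝ)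
    (hM : ∀ j, j ≠ j₁ → ∀ y : B1Eq324BenfattoLemma.Site d,
      ∑ p ∈ Finset.Icc 1 s, ∑ Δ ∈ T j p, ∑ n ∈ admissible p D,
        |a p (fun i => (Δ i : B1Eq324BenfattoLemma.Site d)) n| *
          Real.exp (-(ϰ / 2) * connLength fun i => (Δ i : B1Eq324BenfattoLemma.Site d)) *
          (Real.exp (δ / 2 * ((D : ℝ) ^ 2 * (Real.sqrt d * connLength (fun i => (Δ i : B1Eq324BenfattoLemma.Site d)) + d))) *
            Real.exp (-(δ / (2 * Fintype.card σ) * ∑ jj, |((y jj : ℝ) -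
              ((if h : 0 < p then (Δ ⟨0, h⟩ : B1Eq324BenfattoLemma.Site d) else (0 : B1Eq324BenfattoLemma.Site d)) jj : ℝ))|))) ≤ M j) :
    |ursellOf (fun P : Finset σ => ∫ z, ∏ j ∈ P,
        (∑ p ∈ Finset.Icc 1 s, ∑ Δ ∈ T j p, ∑ n ∈ admissible p D, term ϰ a z p Δ n) ∂(gaussianFieldOfKernel K))
        Finset.univ| ≤
      2 ^ (Fintype.card σ * D) * 2 ^ 2 ^ (Fintype.card σ * D) * K₀ ^ (Fintype.card σ * D) *
        (∑ p₁ ∈ Finset.Icc 1 s, ∑ Δ₁ ∈ T j₁ p₁, ∑ n₁ ∈ admissible p₁ D,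
          |a p₁ (fun i => (Δ₁ i : B1Eq324BenfattoLemma.Site d)) n₁| *
            Real.exp (-(ϰ / 2) * connLength fun i => (Δ₁ i : B1Eq324BenfattoLemma.Site d)) *
            Real.exp (δ / 2 * ((D : ℝ) ^ 2 * (Real.sqrt d * connLength (fun i => (Δ₁ i : B1Eq324BenfattoLemma.Site d)) + d)))) *
        ∏ j ∈ Finset.univ.erase j₁, M j := by
  have h := abs_ursellOf_tupleSums_shift_le_anchored_of_uniform (s := s) (D := D) (ϰ := ϰ) (a := a) hK (fun _ => (0 : ℝ)) hdiag T
    hK₀ hdec (fun j p _ Δ _ i => by rw [abs_zero]; exact zero_le_one.trans hK₀) hδ hδle j₁ M hM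
  rwa [map_add_zero_eq'] at h

end Literature.MathematicalPhysics.QuantumFieldTheory.Balaban1983to89.B1Eq324BenfattoKernelSect5TupleClustersAnchored
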